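/-
Copyright: the b2b-balaban cell (near-miss cell 7), T⁴-continuum fan-out, lineage t4-ne7b-p3 (node U5c LARGE-DEVIATION
member P3).  Released under the licence of the surrounding project.
-/
import Summits.QuantumFields.BalabanUV.T4Continuum.Support.SpaceTimeRealisedT
import Summits.QuantumFields.BalabanUV.T4Continuum.Support.HistoryRealiseCellsRun

/-!
# Space-time Peierls ∕ Cramér route for NE7b — THE ADAPTER TO THE ROW OWNER's H3 CARRIER: the COUNT swarm's
# `RealisedDomainsR` (realised pending pedigrees with their domains, per run) IS realised lineage data `RLin`, and its
# field `real` IS reading (iv‴) — so the identification hypothesis of the CONTOUR route is the owner's, BY NAME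

Summits-side support leaf of the T⁴-continuum cell (rung (B)+1 on a FINITE torus only; NOT infinite volume, NOT the
mass gap, NOT the Clay statement; NOT a proof of the spine estimate NE7b).  Lineage `t4-ne7b-p3` (generation 3), node
U5c, skeleton `t4/skeletons/NE7b-t4-ne7b-p3.md` §14.  [folklore] plumbing over this lineage's `SpaceTimeRealisedT`
(`RLin.lineageReadingsT`) and the COUNT swarm's `HistoryRealiseCellsRun.RealisedDomainsR` (typer T-NE7b-7 (R7-a); the
H3 display of the owner's END `HistoryAssemblyRealiseRunEnd.hybridNE7_of_realisedRun_printed`), `HistoryGen.Pedigree`,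
`HistoryGenBridge.Pedigree.toPGen` — all BY NAME; nothing printed is asserted; no `[cite:]` tag.

WHAT.
* **`RLin.ofDomains`**: for a run `K` of the owner's reading map (`T`, `ped`, `cellP`, `liveC`, `Z`, exponents `s K`),
  the realised lineage data of the CONTOUR route: terms `T K`, lineages `(τ, c)` for `c ∈ liveC K τ`, history
  `(ped K τ).toPGen (cellP K τ) c` (the owner's `PGen` of the component — a CHAIN OF JOINS at one step for a component
  with several parts, admitted on the tagged road), domain `Z K τ c`, flow exponents `s K`; levels `levelOf (s K) K`,
  torus exponent `K` (the owner's `inBox` convention).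
* **`RLin.real_ofDomains`**: the owner's field `RealisedDomainsR.real` IS reading (iv‴) of `RLin.lineageReadingsT` for
  `ofDomains` — `Realises L (s K) (R K) P Z ∧ PendingAt L (s K) (R K) P.lastStep Z K` per lineage.
* **`RLin.lineageReadingsT_ofDomains`**: hence the tagged lineage readings for the owner's realised reading, from the
  SAME structure `H : RealisedDomainsR …` the owner's END consumes, plus the flow side conditions and readings (i) (ii′)
  (iii′) (v″) (vi).
So the identification hypothesis (a) of this route is — by kernel, not by prose — the row owner's H3 structure.

HONEST DEPENDENCY (cell, verbatim): continuum YM on T⁴ ⇐ BetaPertH ∧ nine spine estimates (0/9 proved); BetaPertH ⇐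
(D1) ∧ (D4) ∧ CAP+tail; G-an2-4 gates asym, D1 and NE2/3/4.  This file changes none of it.
-/

open Finset

namespace Summit.QuantumFields.BalabanUV.T4Continuum.SpaceTimePeierls

open Literature.MathematicalPhysics.QuantumFieldTheory.Balaban1983to89
open Literature.MathematicalPhysics.QuantumFieldTheory.Balaban1983to89.B13ScaleTransfer
open Literature.MathematicalPhysics.QuantumFieldTheory.Balaban1983to89.B16SProfile
open T4PersistenceDictionary T4BankedInduction T4PrintedShapeBanking
open T4TaggedShapeBanking (dictWT costT)
open Summit.QuantumFields.BalabanUV.T4Continuum.ZoneTorus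
open Summit.QuantumFields.BalabanUV.T4Continuum.HistoryZones (levelOf)
open Summit.QuantumFields.BalabanUV.T4Continuum.HistoryGen
open Summit.QuantumFields.BalabanUV.T4Continuum.HistoryAdmissible
open Summit.QuantumFields.BalabanUV.T4Continuum.HistoryRealise
open Summit.QuantumFields.BalabanUV.T4Continuum.HistoryRealiseCellsRun (RealisedDomainsR)
open SpaceTimePeierlsLeaves

noncomputable section

open Classical

namespace RLin

variable {d n L K K₀ : ℕ} {ι α π : Type*} [DecidableEq ι] [DecidableEq α]
  (s : ℕ → ℕ → ℕ) (R : ℕ → ℕ → ℕ) (T : ℕ → Finset ι) (ped : ℕ → ι → Pedigree α π)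
  (cellP : ℕ → ι → π → Pt d × Finset (Pt d)) (liveC : ℕ → ι → Finset α) (Z : ℕ → ι → α → Finset (Pt d))

/-- **THE OWNER's REALISED READING OF RUN `K` AS REALISED LINEAGE DATA**: terms `T K`; lineages `(τ, c)`, `c` a live
component of `τ`; history = the owner's `PGen` of the component; domain `Z K τ c`; exponents `s K`; levels
`levelOf (s K) K`, torus `n·L^K` (nonempty torus and levels inside it are the two side conditions). [folklore] -/
def ofDomains (K : ℕ) (hN : 0 < n * L ^ K) (hℓK : ∀ u, u ≤ K → levelOf (s K) K u ≤ K) :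
    RLin d n L K K (levelOf (s K) K) ι (ι × α) where
  hN := hN
  hℓK := hℓK
  T := T K
  fam := fun τ => (liveC K τ).image (Prod.mk τ)
  P := fun lam => (ped K lam.1).toPGen (cellP K lam.1) lam.2
  Z := fun lam => Z K lam.1 lam.2
  s := s K

variable {s R T ped cellP liveC Z}

/-- a lineage of `τ` is a live component of `τ` [folklore] -/
theorem mem_fam_ofDomains {K : ℕ} {hN : 0 < n * L ^ K} {hℓK : ∀ u, u ≤ K → levelOf (s K) K u ≤ K} {τ : ι}
    {lam : ι × α} (h : lam ∈ (ofDomains s T ped cellP liveC Z K hN hℓK).fam τ) :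
    lam.1 = τ ∧ lam.2 ∈ liveC K τ := by
  simp only [ofDomains, mem_image] at h
  obtain ⟨c, hc, rfl⟩ := h
  exact ⟨rfl, hc⟩

/-- **THE OWNER's FIELD `real` IS READING (iv‴)**: for `K ≥ K₀`, every lineage of every term of run `K` is realised
along `s K` with sizes `R K` and pending at `K`. [folklore] -/
theorem real_ofDomains (H : RealisedDomainsR L s n K₀ R T ped cellP liveC Z) {K : ℕ} (hK : K₀ ≤ K)
    {hN : 0 < n * L ^ K} {hℓK : ∀ u, u ≤ K → levelOf (s K) K u ≤ K} :
    ∀ τ ∈ (ofDomains s T ped cellP liveC Z K hN hℓK).T,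
      ∀ lam ∈ (ofDomains s T ped cellP liveC Z K hN hℓK).fam τ,
        Realises L (ofDomains s T ped cellP liveC Z K hN hℓK).s (R K)
            ((ofDomains s T ped cellP liveC Z K hN hℓK).P lam)
            ((ofDomains s T ped cellP liveC Z K hN hℓK).Z lam) ∧
          PendingAt L (ofDomains s T ped cellP liveC Z K hN hℓK).s (R K)
            ((ofDomains s T ped cellP liveC Z K hN hℓK).P lam).lastStep
            ((ofDomains s T ped cellP liveC Z K hN hℓK).Z lam) K := by
  intro τ hτ lam hlam
  obtain ⟨h1, h2⟩ := mem_fam_ofDomains hlam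
  obtain ⟨τ', c⟩ := lam
  simp only at h1
  subst h1
  exact H.real K hK _ hτ c h2

/-- **THE TAGGED LINEAGE READINGS FOR THE OWNER's REALISED READING.**  From the SAME structure
`H : RealisedDomainsR L s n K₀ R T ped cellP liveC Z` that the owner's END consumes (its field `real` only), a run
`K ≥ K₀`, the flow side conditions for `s K` and `R K`, and readings (i) (ii′) (iii′) (v″) (vi) of
`RLin.lineageReadingsT`: the tagged lineage readings of run `K` — with NO further hypothesis on the histories.
[folklore] -/
theorem lineageReadingsT_ofDomains (H : RealisedDomainsR L s n K₀ R T ped cellP liveC Z) {K : ℕ} (hK : K₀ ≤ K)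
    {hN : 0 < n * L ^ K} {hℓK : ∀ u, u ≤ K → levelOf (s K) K u ≤ K}
    {C : T4PrintedShapeBanking.Consts} {Kc : ℕ} {g : ℕ → ℝ} {A : ι → ℝ} {Bad : Finset ι} {jlo : ℕ} {nup c₃ : ℝ}
    {rest : Finset (STCellV d n L K K (levelOf (s K) K)) → ι → ℝ}
    (hn : 0 < n) (hL : 4 ≤ L) (hmono : ∀ u, levelOf (s K) K u ≤ levelOf (s K) K (u + 1))
    (hjump : ∀ u, levelOf (s K) K (u + 1) ≤ levelOf (s K) K u + 2)
    (hqℓ : ∀ u, ratio L (s K) u = L ^ (levelOf (s K) K (u + 1) - levelOf (s K) K u))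
    (hdrop : ∀ m, DropCtl (s K) m) (hR : ∀ t, 1 ≤ R K t) (hn₁ : 13 ≤ C.n₁) (hKc : K ≤ Kc)
    (hnonneg : ∀ τ ∈ T K, 0 ≤ A τ) (hBad : Bad ⊆ T K) (hjlo : jlo ≤ K)
    (hold : ∀ τ ∈ Bad, ∃ c ∈ liveC K τ, ((ped K τ).toPGen (cellP K τ) c).rootStep ≤ jlo)
    (hsep : (ofDomains s T ped cellP liveC Z K hN hℓK).LatSepT)
    (hfac : ∀ (𝒦 : Finset (STCellV d n L K K (levelOf (s K) K))), ∀ τ ∈ T K,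
      (ofDomains s T ped cellP liveC Z K hN hℓK).toLinDataT.model.IsContour τ 𝒦 → ∀ c ∈ liveC K τ,
      (∀ x ∈ 𝒦, (ofDomains s T ped cellP liveC Z K hN hℓK).toLinDataT.InLin (τ, c) x) →
        A τ ≤ Real.exp (-(credits (credit C g ∘ Prod.snd) (toGenT 0 ((ped K τ).toPGen (cellP K τ) c)) -
          lifeCost (dictWT Prod.snd (R K) C.n₁) (costT Prod.snd C Kc (R K))
            (toGenT 0 ((ped K τ).toPGen (cellP K τ) c)))) * rest 𝒦 τ)
    (hrest0 : ∀ (𝒦 : Finset (STCellV d n L K K (levelOf (s K) K))), ∀ τ ∈ T K, 0 ≤ rest 𝒦 τ)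
    (hrest : ∀ (𝒦 : Finset (STCellV d n L K K (levelOf (s K) K))),
      ∑ τ ∈ (ofDomains s T ped cellP liveC Z K hN hℓK).toLinDataT.model.T.filter
          (fun τ => (ofDomains s T ped cellP liveC Z K hN hℓK).toLinDataT.model.IsContour τ 𝒦), rest 𝒦 τ ≤
        Real.exp c₃ ^ 𝒦.card * nup) :
    LineageReadingsT (ofDomains s T ped cellP liveC Z K hN hℓK).toLinDataT.model C K Kc (R K) g A Bad jlo nup
      (3 ^ d + L ^ (2 * d) + 1) ((((3 ^ d + L ^ (2 * d) + 1 : ℕ) : ℝ) + 1) ^ 2)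
      (((n * L ^ (K - levelOf (s K) K K)) ^ d : ℕ) : ℝ) (8 * 126 ^ d) (126 ^ d) ((127 : ℝ) ^ d + 3) c₃ := by
  refine (ofDomains s T ped cellP liveC Z K hN hℓK).lineageReadingsT hn hL hmono hjump hqℓ hdrop hR hn₁ hKc hnonneg
    hBad hjlo (fun τ hτ => ?_) hsep (real_ofDomains H hK) (fun 𝒦 τ hτ h𝒦 lam hlam hin => ?_) hrest0 hrest
  · obtain ⟨c, hc, hroot⟩ := hold τ hτ
    exact ⟨(τ, c), mem_image_of_mem _ hc, hroot⟩
  · obtain ⟨h1, h2⟩ := mem_fam_ofDomains hlam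
    obtain ⟨τ', c⟩ := lam
    simp only at h1
    subst h1
    exact hfac 𝒦 _ hτ h𝒦 c h2 hin

end RLin

end

end Summit.QuantumFields.BalabanUV.T4Continuum.SpaceTimePeierls
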